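import Summits.QuantumAdvantage.AdviceFreeQNC0.LevelSetDegreeOne
import Summits.QuantumAdvantage.AdviceFreeQNC0.SparseSupportResidueBalance
import HarnessLib

/-!
# Cell qa-qnc0 (rung F-Q1, route RingFrame, crux α, line `product`): cubes — the iterated-derivative
# identity and the transfer `CubeCover ⟹ FSB` at every fixed column degree (planner qa-qnc0-p1 T6)

Planner qa-qnc0-p1's THEOREM-TARGET T6 (HOME/qa-qnc0-p1/ROUND-8.md §1, `Sketch9.lean` §21.1, ask P7),
statements VERBATIM (`cubeVertex`, `CubeIdentity`, `CubeCoverAt`, `CubeCover`, `CubeCoverAll`,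
`DistFailXor3`, `FSBDeg`, `FSBDegOfCubeCover`), with the two Γ-independent legs PROVED:
* `cubeIdentity : CubeIdentity` (T6(a)): if every column `u ↦ Γ u v` has `𝔽₂`-degree `≤ D`, then for
  every `x` and EVERY `D+1` directions (dependent ones too) the `2^{D+1}` values `Γ(x + a_S) v`,
  `S ⊆ [D+1]`, have even parity — more derivatives than degree kill a polynomial
  (`sum_powerset_lowDeg_cubeVertex_eq_zero`, induction on the direction set, topic's `deriv_mem_lowDeg`).
* `distFail_paritySum_le` (the odd-sum iteration `(*)` of ROUND-8 §1(a)): the potential cost is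
  subadditive over XOR-sums with an ODD number of terms (iterate `distFail_xor3_le`: the fail family
  `𝟙 + C` is affine), whence `distFail_le_sum_cubeVertex`:
  `distFail D (Γ x) ≤ Σ_{S ≠ ∅} distFail D (Γ (x + a_S))` for column degree `≤ D`.
* `fsbDegOfCubeCover : FSBDegOfCubeCover` (T6(c), threshold form): with `B := FAR_{τ/2^{D+1}} ∩ cls r`,
  either `(2^{D+1} − 1)·#B ≤ ½·#cls r` — then `CubeCover D ½` puts at EVERY row `x` a cube with all
  `2^{D+1} − 1` positive vertices `(τ/2^{D+1})`-near, so `distFail D (Γ x) < τ·2^{L'}` and `FAR_τ = ∅` —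
  or `#B > #cls r/(2(2^{D+1} − 1)) ≥ 2^L/2^{D+4} ≥ 2^{−D−4}·#FAR_τ` (`L ≥ 3`); packaged as
  `fsbDeg_of_cubeCover : CubeCover D ½ → ∀ τ > 0, FSBDeg D 2^{D+1} 2^{−D−4} τ 0`.
The remaining leg `CubeCover D η` (T6(b)) is NOT in this file (`D = 1`, `η = 1/10` is
`three_xor_cover_of_dense_weightClass`, `WeightClassSumsets.lean`).  WHAT THIS IS NOT: nothing on
`FSB` at polylog column degree, on `FW`/`LDRAgg`, or on α; constants are the dual-distance ones
(`2^{−Θ(D)}`); no separation claim.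
-/

noncomputable section
noncomputable section

namespace Summit.QuantumAdvantage.AdviceFreeQNC0

open Finset
open Literature.Computability.MetaComplexity Literature.Computability.MetaComplexity.Smolensky
open Literature.Computability.MetaComplexity.GowersCube

/-! ### Vocabulary (verbatim from `Sketch9` §21.1) -/

/-- the cube vertex `x + Σ_{i ∈ S} a i`. -/
def cubeVertex {L m : ℕ} (x : Fin L → Bool) (a : Fin m → (Fin L → Bool)) (S : Finset (Fin m)) :
    Fin L → Bool :=
  fun ℓ => xor (x ℓ) (decide ((S.filter fun i => a i ℓ = true).card % 2 = 1))

/-- (21.1.a) column degree `≤ D` ⇒ every `(D+1)`-cube sum of rows vanishes coordinatewise. -/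
def CubeIdentity : Prop :=
  ∀ (L L' D : ℕ) (Γ : (Fin L → Bool) → (Fin L' → Bool) → Bool),
    (∀ v, HasDeg (fun u => Γ u v) D) →
    ∀ (x : Fin L → Bool) (a : Fin (D + 1) → (Fin L → Bool)) (v : Fin L' → Bool),
      Even ((univ : Finset (Finset (Fin (D + 1)))).filter
        fun S => Γ (cubeVertex x a S) v = true).card

/-- (21.1.b) `CubeCover` at one length `L`: if `(2^{D+1}-1)·|cls r \ A| ≤ (1-η)|cls r|` then EVERY
`x` is the `∅`-vertex of a `(D+1)`-cube whose `2^{D+1}-1` other vertices lie in `A`. -/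
def CubeCoverAt (L D : ℕ) (η : ℝ) : Prop :=
  ∀ r : ℕ, ∀ A : Finset (Fin L → Bool), A ⊆ cls L r →
    ((2 : ℝ) ^ (D + 1) - 1) * ((cls L r \ A).card : ℝ) ≤ (1 - η) * ((cls L r).card : ℝ) →
    ∀ x : Fin L → Bool, ∃ a : Fin (D + 1) → (Fin L → Bool),
      ∀ S : Finset (Fin (D + 1)), S.Nonempty → cubeVertex x a S ∈ A

/-- `CubeCover D η`: eventually in `L` (expected `L₀ ≈ 35·4^{D+1}`). `D = 1, η = 1/10` is
`three_xor_cover_of_dense_weightClass` (p457642). -/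
def CubeCover (D : ℕ) (η : ℝ) : Prop := ∃ L₀ : ℕ, ∀ L ≥ L₀, CubeCoverAt L D η

/-- `CubeCover` at every degree and every `η > 0`. -/
def CubeCoverAll : Prop := ∀ D : ℕ, ∀ η : ℝ, 0 < η → CubeCover D η

/-- odd-subadditivity of the fail distance (3 terms; iterate for odd sums). -/
def DistFailXor3 : Prop :=
  ∀ (L' D : ℕ) (x y z : (Fin L' → Bool) → Bool),
    distFail D (fun v => xor (x v) (xor (y v) (z v))) ≤ distFail D x + distFail D y + distFail D z

/-- `FSB` at ONE fixed column degree `D` (no polylog quantifier). -/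
def FSBDeg (D : ℕ) (c κ' τ τ'' : ℝ) : Prop :=
  ∃ L₀ : ℕ, ∀ L L' : ℕ, L₀ ≤ L → L₀ ≤ L' →
    ∀ Γ : (Fin L → Bool) → (Fin L' → Bool) → Bool, (∀ v, HasDeg (fun u => Γ u v) D) →
    ∀ r : ℕ, κ' * ((far D Γ τ).card : ℝ) - τ'' * (2 : ℝ) ^ L ≤ ((far D Γ (τ / c) ∩ cls L r).card : ℝ)

/-- (21.1.c) THEOREM-TARGET T6 (threshold form): cubes give `FSB` at every fixed degree with the
dual-distance constants `c = 2^{D+1}`, `κ' = 2^{-D-4}`, `τ'' = 0`. -/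
def FSBDegOfCubeCover : Prop :=
  CubeIdentity → DistFailXor3 → ∀ D : ℕ, CubeCover D (1 / 2) → ∀ τ : ℝ, 0 < τ →
    FSBDeg D ((2 : ℝ) ^ (D + 1)) (1 / (2 : ℝ) ^ (D + 4)) τ 0

/-! ### The cube vertices -/

variable {L m : ℕ}

/-- Parity flips under successor. -/
private theorem decide_succ_mod_two (n : ℕ) : decide ((n + 1) % 2 = 1) = !decide (n % 2 = 1) := by
  rcases Nat.mod_two_eq_zero_or_one n with hn | hn
  · have h1 : (n + 1) % 2 = 1 := by omega
    simp [hn, h1]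
  · have h1 : (n + 1) % 2 = 0 := by omega
    simp [hn, h1]

/-- The `∅`-vertex is the base point. -/
theorem cubeVertex_empty (x : Fin L → Bool) (a : Fin m → (Fin L → Bool)) : cubeVertex x a ∅ = x := by
  funext ℓ
  simp [cubeVertex]

/-- Adding a fresh generator shifts the vertex: `x + a_{S ∪ {i}} = (x + a_S) ⊕ a_i`. -/
theorem cubeVertex_insert (x : Fin L → Bool) (a : Fin m → (Fin L → Bool)) {i : Fin m}
    {S : Finset (Fin m)} (hi : i ∉ S) :
    cubeVertex x a (insert i S) = xorShift (cubeVertex x a S) (a i) := by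
  funext ℓ
  simp only [cubeVertex, xorShift, Finset.filter_insert]
  by_cases h : a i ℓ = true
  · rw [if_pos h, Finset.card_insert_of_notMem (fun h' => hi (Finset.mem_filter.1 h').1), h,
      decide_succ_mod_two]
    generalize x ℓ = b
    generalize decide ((S.filter fun j => a j ℓ = true).card % 2 = 1) = d
    cases b <;> cases d <;> rfl
  · rw [if_neg h]
    have h' : a i ℓ = false := by simpa using h
    rw [h', Bool.xor_false]

/-! ### T6(a): the iterated-derivative identity -/

/-- **More derivatives than degree kill a polynomial.**  For `g` of `𝔽₂`-degree `≤ D` on the cube and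
any set `I` of `≥ D+1` directions, `Σ_{S ⊆ I} g(x + a_S) = 0`. [folklore; Viola–Wigderson 2008 §2.1] -/
theorem sum_powerset_lowDeg_cubeVertex_eq_zero (x : Fin L → Bool) (a : Fin m → (Fin L → Bool)) :
    ∀ (I : Finset (Fin m)) (D : ℕ) (g : CubeFn (ZMod 2) L), g ∈ lowDeg (ZMod 2) L D →
      D + 1 ≤ I.card → ∑ S ∈ I.powerset, g (cubeVertex x a S) = 0 := by
  intro I
  induction I using Finset.induction_on with
  | empty => intro D g _ hcard; simp at hcard
  | insert i I hi ih =>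
    intro D g hg hcard
    rw [Finset.sum_powerset_insert hi]
    have e : ∀ S ∈ I.powerset, g (cubeVertex x a (insert i S)) = g (xorShift (cubeVertex x a S) (a i)) := by
      intro S hS
      rw [cubeVertex_insert x a (fun h => hi (Finset.mem_powerset.1 hS h))]
    rw [Finset.sum_congr rfl e, ← Finset.sum_add_distrib]
    change ∑ S ∈ I.powerset, deriv (a i) g (cubeVertex x a S) = 0
    rcases Nat.eq_zero_or_pos D with rfl | hD
    · -- degree `0`: `g` is constant, its derivative vanishes identically
      have hc := eq_const_of_mem_lowDeg_zero hg x
      refine Finset.sum_eq_zero fun S _ => ?_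
      unfold deriv
      rw [hc]
      simp only [Pi.smul_apply, Pi.one_apply, smul_eq_mul, mul_one]
      exact CharTwo.add_self_eq_zero _
    · have hcard' : D - 1 + 1 ≤ I.card := by
        rw [Finset.card_insert_of_notMem hi] at hcard; omega
      exact ih (D - 1) (deriv (a i) g) (deriv_mem_lowDeg hg (a i)) hcard'

/-- **T6(a) `CubeIdentity`** (planner qa-qnc0-p1, Sketch9 §21.1(a)): column degree `≤ D` ⇒ every
`(D+1)`-cube sum of rows vanishes coordinatewise. -/
theorem cubeIdentity : CubeIdentity := by
  intro L L' D Γ hΓ x a v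
  have h0 : ∑ S : Finset (Fin (D + 1)),
      (if Γ (cubeVertex x a S) v = true then (1 : ZMod 2) else 0) = 0 := by
    have h := sum_powerset_lowDeg_cubeVertex_eq_zero x a univ D _ (hΓ v)
      (by rw [Finset.card_univ, Fintype.card_fin])
    simpa only [Finset.powerset_univ] using h
  rw [Finset.sum_boole] at h0
  exact (ZMod.natCast_eq_zero_iff_even).1 h0

/-! ### The odd-sum iteration of the triple subadditivity -/

variable {ℓ : ℕ}

/-- XOR of a finite family of Boolean functions. -/
def paritySum {κ : Type*} (s : Finset κ) (g : κ → (Fin ℓ → Bool) → Bool) : (Fin ℓ → Bool) → Bool :=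
  fun v => decide ((s.filter fun j => g j v = true).card % 2 = 1)

/-- One term. -/
theorem paritySum_singleton {κ : Type*} (j : κ) (g : κ → (Fin ℓ → Bool) → Bool) :
    paritySum {j} g = g j := by
  funext v
  unfold paritySum
  by_cases h : g j v = true
  · rw [Finset.filter_singleton, if_pos h, Finset.card_singleton, h]; decide
  · rw [Finset.filter_singleton, if_neg h, Finset.card_empty]
    have h' : g j v = false := by simpa using h
    rw [h']; decide

/-- Peeling one term: `⊕_{s ∪ {j}} = g j ⊕ (⊕_s)`. -/
theorem paritySum_insert {κ : Type*} [DecidableEq κ] {s : Finset κ} (g : κ → (Fin ℓ → Bool) → Bool) {j : κ}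
    (hj : j ∉ s) : paritySum (insert j s) g = fun v => xor (g j v) (paritySum s g v) := by
  funext v
  unfold paritySum
  rw [Finset.filter_insert]
  by_cases h : g j v = true
  · rw [if_pos h, Finset.card_insert_of_notMem (fun h' => hj (Finset.mem_filter.1 h').1), h,
      decide_succ_mod_two, Bool.true_xor]
  · rw [if_neg h]
    have h' : g j v = false := by simpa using h
    rw [h', Bool.false_xor]

/-- **Subadditivity over odd XOR-sums.** For an odd number of rows, the potential cost of their XOR
is at most the sum of their potential costs (iterate `distFail_xor3_le`). -/
theorem distFail_paritySum_le {κ : Type*} [DecidableEq κ] (D : ℕ) (g : κ → (Fin ℓ → Bool) → Bool) :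
    ∀ (k : ℕ) (s : Finset κ), s.card = 2 * k + 1 →
      distFail D (paritySum s g) ≤ ∑ j ∈ s, distFail D (g j) := by
  intro k
  induction k with
  | zero =>
    intro s hs
    obtain ⟨j, rfl⟩ := Finset.card_eq_one.1 (by simpa using hs)
    rw [paritySum_singleton, Finset.sum_singleton]
  | succ k ih =>
    intro s hs
    have hpos : 0 < s.card := by omega
    obtain ⟨j₁, h₁⟩ := Finset.card_pos.1 hpos
    have hpos' : 0 < (s.erase j₁).card := by rw [Finset.card_erase_of_mem h₁]; omega
    obtain ⟨j₂, h₂⟩ := Finset.card_pos.1 hpos'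
    have hcard : ((s.erase j₁).erase j₂).card = 2 * k + 1 := by
      rw [Finset.card_erase_of_mem h₂, Finset.card_erase_of_mem h₁]; omega
    have hrec := ih _ hcard
    have hs' : s = insert j₁ (insert j₂ ((s.erase j₁).erase j₂)) := by
      rw [Finset.insert_erase h₂, Finset.insert_erase h₁]
    rw [hs', paritySum_insert g (fun h => (Finset.mem_insert.1 h).elim
        (fun e => Finset.ne_of_mem_erase h₂ e.symm) (fun h' => Finset.notMem_erase j₁ s
          (Finset.mem_of_mem_erase h'))),
      Finset.sum_insert (fun h => (Finset.mem_insert.1 h).elim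
        (fun e => Finset.ne_of_mem_erase h₂ e.symm) (fun h' => Finset.notMem_erase j₁ s
          (Finset.mem_of_mem_erase h'))),
      Finset.sum_insert (Finset.notMem_erase j₂ _)]
    simp only [paritySum_insert g (Finset.notMem_erase j₂ (s.erase j₁))]
    have h3 := distFail_xor3_le D (g j₁) (g j₂) (paritySum ((s.erase j₁).erase j₂) g)
    omega

/-- `DistFailXor3` holds (the topic's `distFail_xor3_le`). -/
theorem distFailXor3 : DistFailXor3 := fun _ D x y z => distFail_xor3_le D x y z

/-- There are `2^{D+1} − 1` positive vertices. -/
theorem card_filter_nonempty_add_one (D : ℕ) :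
    ((univ : Finset (Finset (Fin (D + 1)))).filter (fun S => S.Nonempty)).card + 1 = 2 ^ (D + 1) := by
  have h1 : ((univ : Finset (Finset (Fin (D + 1)))).filter fun S => ¬ S.Nonempty).card = 1 := by
    rw [Finset.card_eq_one]
    exact ⟨∅, by ext S; simp [Finset.not_nonempty_iff_eq_empty]⟩
  have h2 := Finset.card_filter_add_card_filter_not
    (s := (univ : Finset (Finset (Fin (D + 1))))) (fun S : Finset (Fin (D + 1)) => S.Nonempty)
  rw [h1, Finset.card_univ, Fintype.card_finset, Fintype.card_fin] at h2
  exact h2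

/-- **`(*)` of ROUND-8 §1(a).** For column degree `≤ D`, every row is the XOR of the `2^{D+1} − 1`
positive vertices of any of its `(D+1)`-cubes, so `distFail D (Γ x) ≤ Σ_{S ≠ ∅} distFail D (Γ(x + a_S))`. -/
theorem distFail_le_sum_cubeVertex {L' D : ℕ} (Γ : (Fin L → Bool) → (Fin L' → Bool) → Bool)
    (hΓ : ∀ v, HasDeg (fun u => Γ u v) D) (x : Fin L → Bool) (a : Fin (D + 1) → (Fin L → Bool)) :
    distFail D (Γ x) ≤ ∑ S ∈ (univ : Finset (Finset (Fin (D + 1)))).filter (fun S => S.Nonempty),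
      distFail D (Γ (cubeVertex x a S)) := by
  set P := (univ : Finset (Finset (Fin (D + 1)))).filter (fun S => S.Nonempty) with hP
  -- `Γ x` is the XOR of the positive vertices' rows
  have hPe : insert ∅ P = univ := by
    ext S
    simp only [hP, Finset.mem_insert, Finset.mem_filter, Finset.mem_univ, true_and, iff_true]
    exact (eq_or_ne S ∅).imp id Finset.nonempty_iff_ne_empty.2
  have hx : Γ x = paritySum P (fun S => Γ (cubeVertex x a S)) := by
    funext v
    have hev := cubeIdentity L L' D Γ hΓ x a v
    have hall : paritySum univ (fun S => Γ (cubeVertex x a S)) v = false := by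
      unfold paritySum
      rw [Nat.even_iff] at hev
      simp [hev]
    rw [← hPe, paritySum_insert _ (fun h => by simp [hP] at h), cubeVertex_empty] at hall
    beta_reduce at hall
    revert hall
    generalize Γ x v = p
    generalize paritySum P (fun S => Γ (cubeVertex x a S)) v = q
    cases p <;> cases q <;> simp
  -- the number of positive vertices is odd
  have hcardP : P.card = 2 * (2 ^ D - 1) + 1 := by
    have htot := card_filter_nonempty_add_one D
    rw [← hP] at htot
    have hD : 1 ≤ 2 ^ D := Nat.one_le_two_pow
    have : 2 ^ (D + 1) = 2 * 2 ^ D := by ring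
    omega
  calc distFail D (Γ x) = distFail D (paritySum P (fun S => Γ (cubeVertex x a S))) := by rw [← hx]
    _ ≤ ∑ S ∈ P, distFail D (Γ (cubeVertex x a S)) := distFail_paritySum_le D _ _ P hcardP

/-! ### T6(c): `CubeCover ⟹ FSB` at fixed degree -/

/-- The class `r` has at least `(2^L − 2)/3` elements. -/
theorem three_mul_card_cls_ge (L r : ℕ) : (2 : ℝ) ^ L - 2 ≤ 3 * ((cls L r).card : ℝ) := by
  have h3 := abs_three_mul_card_filter_mod_sub_card_le (univ : Finset (Fin L → Bool)) r
  rw [norm_sum_omega3_pow_wt, Finset.card_univ, Fintype.card_fun, Fintype.card_bool,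
    Fintype.card_fin] at h3
  push_cast at h3
  rw [abs_le] at h3
  have e : (univ.filter fun u : Fin L → Bool =>
      Literature.Computability.MetaComplexity.Hegedus.wt u % 3 = r % 3) = cls L r := rfl
  rw [e] at h3
  linarith [h3.1]

/-- **T6(c), unpacked.**  `CubeCover D ½` gives far-set balance at column degree `D` with the
dual-distance constants: for `L, L' ≥ max L₀ 3`, every column-degree-`D` map and every `r`,
`2^{−D−4}·#FAR_τ ≤ #(FAR_{τ/2^{D+1}} ∩ cls r)`. -/
theorem fsbDeg_of_cubeCover (D : ℕ) (hC : CubeCover D (1 / 2)) (τ : ℝ) (hτ : 0 < τ) :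
    FSBDeg D ((2 : ℝ) ^ (D + 1)) (1 / (2 : ℝ) ^ (D + 4)) τ 0 := by
  obtain ⟨L₀, hL₀⟩ := hC
  refine ⟨max L₀ 3, fun L L' hL _ Γ hΓ r => ?_⟩
  have hcov := hL₀ L (le_trans (le_max_left _ _) hL) r
  have hL3 : 3 ≤ L := le_trans (le_max_right _ _) hL
  rw [zero_mul, sub_zero]
  set M : ℝ := (2 : ℝ) ^ (D + 1) - 1 with hM
  set B := far D Γ (τ / (2 : ℝ) ^ (D + 1)) ∩ cls L r with hB
  set A := cls L r ∩ near D Γ (τ / (2 : ℝ) ^ (D + 1)) with hA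
  have hAsub : A ⊆ cls L r := Finset.inter_subset_left
  have hsd : cls L r \ A = B := by
    rw [hA, hB, ← cls_sdiff_near_eq]
    ext u; simp only [Finset.mem_sdiff, Finset.mem_inter, not_and]
    exact ⟨fun ⟨h1, h2⟩ => ⟨h1, h2 h1⟩, fun ⟨h1, h2⟩ => ⟨h1, fun _ => h2⟩⟩
  have h2pos : (0 : ℝ) < (2 : ℝ) ^ (D + 1) := by positivity
  have hM1 : (1 : ℝ) ≤ M := by
    have : (2 : ℝ) ≤ (2 : ℝ) ^ (D + 1) := by
      calc (2 : ℝ) = 2 ^ 1 := by norm_num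
        _ ≤ 2 ^ (D + 1) := pow_le_pow_right₀ (by norm_num) (by omega)
    rw [hM]; linarith
  by_cases hcase : M * (B.card : ℝ) ≤ (1 - 1 / 2) * ((cls L r).card : ℝ)
  · -- dense case: every row has a cube with near positive vertices, so no row is `τ`-far
    have hfar : far D Γ τ = ∅ := by
      rw [Finset.eq_empty_iff_forall_notMem]
      intro x hx
      obtain ⟨a, ha⟩ := hcov A hAsub (by rw [hsd]; exact hcase) x
      have hle := distFail_le_sum_cubeVertex Γ hΓ x a
      set P := (univ : Finset (Finset (Fin (D + 1)))).filter (fun S => S.Nonempty) with hP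
      have hPcard : (P.card : ℝ) ≤ M := by
        have h3 := card_filter_nonempty_add_one D
        rw [← hP] at h3
        have h4 : ((P.card + 1 : ℕ) : ℝ) = ((2 ^ (D + 1) : ℕ) : ℝ) := by exact_mod_cast h3
        push_cast at h4
        rw [hM]; linarith
      have hlt : ∀ S ∈ P, (distFail D (Γ (cubeVertex x a S)) : ℝ) < τ / (2 : ℝ) ^ (D + 1) * (2 : ℝ) ^ L' := by
        intro S hS
        have hmem := ha S (Finset.mem_filter.1 hS).2
        rw [hA, Finset.mem_inter] at hmem
        have h := hmem.2
        unfold near at h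
        exact (Finset.mem_filter.1 h).2
      have hsum : ((∑ S ∈ P, distFail D (Γ (cubeVertex x a S)) : ℕ) : ℝ) <
          τ * (2 : ℝ) ^ L' := by
        by_cases hPe : P = ∅
        · rw [hPe, Finset.sum_empty]; push_cast; positivity
        · push_cast
          calc ∑ S ∈ P, (distFail D (Γ (cubeVertex x a S)) : ℝ)
              < ∑ _S ∈ P, τ / (2 : ℝ) ^ (D + 1) * (2 : ℝ) ^ L' :=
                Finset.sum_lt_sum_of_nonempty (Finset.nonempty_iff_ne_empty.2 hPe) hlt
            _ = (P.card : ℝ) * (τ / (2 : ℝ) ^ (D + 1) * (2 : ℝ) ^ L') := by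
                rw [Finset.sum_const, nsmul_eq_mul]
            _ ≤ M * (τ / (2 : ℝ) ^ (D + 1) * (2 : ℝ) ^ L') :=
                mul_le_mul_of_nonneg_right hPcard (by positivity)
            _ ≤ (2 : ℝ) ^ (D + 1) * (τ / (2 : ℝ) ^ (D + 1) * (2 : ℝ) ^ L') :=
                mul_le_mul_of_nonneg_right (by rw [hM]; linarith) (by positivity)
            _ = τ * (2 : ℝ) ^ L' := by field_simp
      have hxfar : τ * (2 : ℝ) ^ L' ≤ (distFail D (Γ x) : ℝ) := by
        unfold far at hx; exact (Finset.mem_filter.1 hx).2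
      have hle' : (distFail D (Γ x) : ℝ) ≤ ((∑ S ∈ P, distFail D (Γ (cubeVertex x a S)) : ℕ) : ℝ) := by
        exact_mod_cast hle
      linarith
    rw [hfar, Finset.card_empty]; push_cast; rw [mul_zero]; positivity
  · -- sparse-far case: `#B > #cls r / (2M) ≥ 2^L / 2^{D+4} ≥ 2^{−D−4}·#FAR_τ`
    push Not at hcase
    have hcls := three_mul_card_cls_ge L r
    have hfar_le : ((far D Γ τ).card : ℝ) ≤ (2 : ℝ) ^ L := by
      have : (far D Γ τ).card ≤ 2 ^ L := by
        calc (far D Γ τ).card ≤ (univ : Finset (Fin L → Bool)).card := Finset.card_le_univ _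
          _ = 2 ^ L := by rw [Finset.card_univ, Fintype.card_fun, Fintype.card_bool, Fintype.card_fin]
      exact_mod_cast this
    have hL8 : (8 : ℝ) ≤ (2 : ℝ) ^ L := by
      calc (8 : ℝ) = 2 ^ 3 := by norm_num
        _ ≤ 2 ^ L := pow_le_pow_right₀ (by norm_num) hL3
    have hMle : M ≤ (2 : ℝ) ^ (D + 1) := by rw [hM]; linarith
    have hpow : (2 : ℝ) ^ (D + 4) = (2 : ℝ) ^ (D + 1) * 8 := by ring
    have h1 : (1 - 1 / 2) * ((cls L r).card : ℝ) < (2 : ℝ) ^ (D + 1) * (B.card : ℝ) :=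
      lt_of_lt_of_le hcase (mul_le_mul_of_nonneg_right hMle (by positivity))
    have key : (2 : ℝ) ^ L ≤ (2 : ℝ) ^ (D + 4) * (B.card : ℝ) := by
      rw [hpow]
      have e : (2 : ℝ) ^ (D + 1) * 8 * (B.card : ℝ) = 8 * ((2 : ℝ) ^ (D + 1) * (B.card : ℝ)) := by ring
      rw [e]
      linarith
    rw [div_mul_eq_mul_div, one_mul, div_le_iff₀ (by positivity)]
    calc ((far D Γ τ).card : ℝ) ≤ (2 : ℝ) ^ L := hfar_le
      _ ≤ (2 : ℝ) ^ (D + 4) * (B.card : ℝ) := key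
      _ = (B.card : ℝ) * (2 : ℝ) ^ (D + 4) := mul_comm _ _

/-- **T6(c) `FSBDegOfCubeCover`** (Sketch9 §21.1(c), verbatim): `CubeIdentity → DistFailXor3 → ∀ D,
CubeCover D ½ → ∀ τ > 0, FSBDeg D 2^{D+1} 2^{−D−4} τ 0`. -/
theorem fsbDegOfCubeCover : FSBDegOfCubeCover := fun _ _ D hC τ hτ => fsbDeg_of_cubeCover D hC τ hτ

end Summit.QuantumAdvantage.AdviceFreeQNC0

end
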